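import Summits.AtomisticToContinuum.HydrodynamicLimit.Theorems.CorrectorPressureDecay.Negative.Frame
import Summits.AtomisticToContinuum.HydrodynamicLimit.Theorems.BandCoherenceLDAlongFamilies.Negative.Pathwise
import Summits.AtomisticToContinuum.HydrodynamicLimit.Theorems.LambertianContactSwapCollisionMomentBoundShellEquilibrium
import HarnessLib

/-!
# Band-coherence drift witness, II: Gaussian facts on `ℝ³`

Negative knowledge for the crux `OneFlightGossipEngine.BandCoherenceLDAlongFamilies` (stmt-AtomisticToContinuum-17700):
the GALILEAN-DRIFT WITNESS of refuter-rattack-stmt-AtomisticToContinuum-17700-0 (item evidence WITNESS.md).  The tested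
band-coherence functional `S = Σᵢ 1{η cubᵢ < ‖q̄ᵢ‖} cubBandᵢ` has a non-zero LINEAR response to a uniform boost `D e₀` of
the homogeneous reference law, whose relative-entropy cost `(N+1)D²/2` is QUADRATIC, while the statement demands the
exponential moment at the FIXED tilt `(8Θ̄K₁)⁻¹` to be `≤ e^{ε(N+1)}` for every `ε > 0`.  No Theses declaration is asserted
positively in this file (pure helper theorems, no definitions).

This file (§3): moments of `N(D e₀, id)` needed by the witness — all norm moments are finite (Fernique,
`IsGaussian.memLp_id`; `gaussMeasure u 1` is a Gaussian measure), `E v₀ = D`, the cubic LINEAR RESPONSE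
`E ‖v‖² v₀ = D³ + 5D` (odd moments vanish by the coordinate flip of
`CorrectorPressureDecayNegative.integral_stdGaussian_eq_zero_of_odd`), the sixth-moment bound `E‖v‖⁶ ≤ M := E(1 + ‖ξ‖)⁶` for
`0 ≤ D ≤ 1`, `E‖v‖³ ≤ 1 + M`, and the lower bound on the response of the witness weight
`E[R(‖v‖²)v₀] ≥ 5D − k²D − k³ − E‖v‖⁶/K³` (`gamma_lower`: low cutoff costs `≤ k³`, top cutoff by Markov).
Reused from the tree: `LambertianContactSwapCollisionMomentBound.pow_le_one_add_pow_six`, Mathlib's Fernique moments.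

References: X. Fernique (1970) (Gaussian moments; Mathlib `ProbabilityTheory.IsGaussian.memLp_id`); folklore Gaussian algebra.
-/

noncomputable section

open MeasureTheory ProbabilityTheory Set Filter Topology
open scoped ENNReal InnerProductSpace BigOperators

namespace Summit.AtomisticToContinuum.HydrodynamicLimit.Theorems

namespace BandCoherenceLDNegative

open Literature.MathematicalPhysics.KineticTheory Literature.Analysis.FluidPDE

open LambertianContactSwapCollisionMomentBound (pow_le_one_add_pow_six)

/-! ## §3 Gaussian facts on `ℝ³` -/

section Gauss

/-- The `0`-coordinate of the boost `D e₀` is `D`. [folklore] -/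
theorem smul_e0_apply_zero (D : ℝ) : (D • (EuclideanSpace.single (0 : Fin 3) (1 : ℝ) : V3)) 0 = D := by simp

/-- `⟪D e₀, w⟫ = D w₀`. [folklore] -/
theorem inner_smul_e0_left (D : ℝ) (w : V3) : ⟪D • (EuclideanSpace.single (0 : Fin 3) (1 : ℝ) : V3), w⟫_ℝ = D * w 0 := by
  rw [real_inner_smul_left, EuclideanSpace.inner_single_left]
  simp

/-- `⟪w, D e₀⟫ = D w₀`. [folklore] -/
theorem inner_smul_e0_right (D : ℝ) (w : V3) : ⟪w, D • (EuclideanSpace.single (0 : Fin 3) (1 : ℝ) : V3)⟫_ℝ = D * w 0 := by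
  rw [real_inner_comm, inner_smul_e0_left]

/-- `‖D e₀‖² = D²`. [folklore] -/
theorem norm_smul_e0_sq (D : ℝ) : ‖D • (EuclideanSpace.single (0 : Fin 3) (1 : ℝ) : V3)‖ ^ 2 = D ^ 2 := by
  rw [norm_smul, show ‖(EuclideanSpace.single (0 : Fin 3) (1 : ℝ) : V3)‖ = 1 by simp, mul_one, Real.norm_eq_abs, sq_abs]

/-- `‖D e₀‖ = D` for `D ≥ 0`. [folklore] -/
theorem norm_smul_e0 {D : ℝ} (hD : 0 ≤ D) : ‖D • (EuclideanSpace.single (0 : Fin 3) (1 : ℝ) : V3)‖ = D := by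
  rw [norm_smul, show ‖(EuclideanSpace.single (0 : Fin 3) (1 : ℝ) : V3)‖ = 1 by simp, mul_one, Real.norm_eq_abs, abs_of_nonneg hD]

/-- `(1 + x)⁶ ≤ 64 (1 + x⁶)` for `x ≥ 0` (binomial coefficients sum to `64`). [folklore] -/
theorem one_add_pow_six_le {x : ℝ} (hx : 0 ≤ x) : (1 + x) ^ 6 ≤ 64 + 64 * x ^ 6 := by
  have h0 := pow_le_one_add_pow_six hx (show 0 ≤ 6 by norm_num)
  have h1 := pow_le_one_add_pow_six hx (show 1 ≤ 6 by norm_num)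
  have h2 := pow_le_one_add_pow_six hx (show 2 ≤ 6 by norm_num)
  have h3 := pow_le_one_add_pow_six hx (show 3 ≤ 6 by norm_num)
  have h4 := pow_le_one_add_pow_six hx (show 4 ≤ 6 by norm_num)
  have h5 := pow_le_one_add_pow_six hx (show 5 ≤ 6 by norm_num)
  nlinarith [h0, h1, h2, h3, h4, h5]

/-- `(1 + ‖w‖)⁶` is integrable under the standard Gaussian on `ℝ³` (Fernique). [folklore] -/
theorem integrable_one_add_norm_pow_six_std : Integrable (fun w : V3 => (1 + ‖w‖) ^ 6) (stdGaussian V3) := by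
  have h6 : Integrable (fun w : V3 => ‖w‖ ^ 6) (stdGaussian V3) :=
    (IsGaussian.memLp_id _ 6 (by simp)).integrable_norm_pow (by norm_num)
  refine ((integrable_const (64 : ℝ)).add (h6.const_mul 64)).mono'
    (by fun_prop : Continuous fun w : V3 => (1 + ‖w‖) ^ 6).aestronglyMeasurable (ae_of_all _ fun w => ?_)
  rw [Real.norm_eq_abs, abs_of_nonneg (by positivity)]
  exact one_add_pow_six_le (norm_nonneg w)

/-- The sixth-moment constant `M = E (1 + ‖ξ‖)⁶` of the standard Gaussian is nonnegative. [folklore] -/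
theorem Msix_nonneg : 0 ≤ (∫ w, (1 + ‖w‖) ^ 6 ∂stdGaussian V3) := integral_nonneg fun w => by positivity

/-- All moments of the norm are finite under `N(u, id)` (Fernique; `gaussMeasure u 1` is a Gaussian measure). [folklore] -/
theorem integrable_norm_pow_gauss (u : V3) (n : ℕ) : Integrable (fun v : V3 => ‖v‖ ^ n) (gaussMeasure u 1) := by
  have h := (IsGaussian.memLp_id (gaussMeasure u 1) n (ENNReal.natCast_ne_top n)).integrable_norm_pow'
  simpa using h

/-- A function dominated by `A + B‖v‖⁶` is integrable under `N(u, id)`. [folklore] -/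
theorem integrable_of_le_pow_six (u : V3) {g : V3 → ℝ} (hgm : AEStronglyMeasurable g (gaussMeasure u 1))
    {A B : ℝ} (hg : ∀ v, |g v| ≤ A + B * ‖v‖ ^ 6) : Integrable g (gaussMeasure u 1) :=
  ((integrable_const A).add ((integrable_norm_pow_gauss u 6).const_mul B)).mono' hgm
    (ae_of_all _ fun v => by simpa [Real.norm_eq_abs] using hg v)

/-- First moment of the drift coordinate: `E v₀ = D` under `N(D e₀, id)`. [folklore] -/
theorem integral_coord_gaussD (D : ℝ) : ∫ v, v 0 ∂gaussMeasure (D • (EuclideanSpace.single (0 : Fin 3) (1 : ℝ) : V3)) 1 = D := by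
  rw [integral_coord_gaussMeasure (D • (EuclideanSpace.single (0 : Fin 3) (1 : ℝ) : V3)) one_pos 0]
  exact smul_e0_apply_zero D

/-- `E ‖w‖² w₀ = 0` under the standard Gaussian (odd under the flip of the `0`-coordinate). [folklore] -/
theorem integral_norm_sq_mul_coord_std : ∫ w, ‖w‖ ^ 2 * w 0 ∂stdGaussian V3 = 0 := by
  refine CorrectorPressureDecayNegative.integral_stdGaussian_eq_zero_of_odd
    (LinearIsometryEquiv.piLpCongrRight 2 fun j : Fin 3 =>
      if j = (0 : Fin 3) then LinearIsometryEquiv.neg ℝ else LinearIsometryEquiv.refl ℝ ℝ) fun v => ?_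
  rw [LinearIsometryEquiv.norm_map]
  have h := CorrectorPressureDecayNegative.coordFlip_apply 0 v 0
  simp only [if_true] at h
  rw [show ((LinearIsometryEquiv.piLpCongrRight 2 fun j : Fin 3 =>
      if j = (0 : Fin 3) then LinearIsometryEquiv.neg ℝ else LinearIsometryEquiv.refl ℝ ℝ) v) 0 = -v 0 from h]
  ring

/-- **The cubic linear response**: `E ‖v‖² v₀ = D³ + 5D` under `N(D e₀, id)`. [folklore] -/
theorem integral_norm_sq_mul_coord_gaussD (D : ℝ) :
    ∫ v, ‖v‖ ^ 2 * v 0 ∂gaussMeasure (D • (EuclideanSpace.single (0 : Fin 3) (1 : ℝ) : V3)) 1 = D ^ 3 + 5 * D := by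
  rw [integral_gaussMeasure _ one_pos]
  simp only [Real.sqrt_one, one_smul]
  have hexp : ∀ w : V3, ‖D • (EuclideanSpace.single (0 : Fin 3) (1 : ℝ) : V3) + w‖ ^ 2 * (D • (EuclideanSpace.single (0 : Fin 3) (1 : ℝ) : V3) + w) 0 =
      D ^ 3 + 3 * D ^ 2 * w 0 + 2 * D * (w 0) ^ 2 + D * ‖w‖ ^ 2 + ‖w‖ ^ 2 * w 0 := by
    intro w
    have ha : (D • (EuclideanSpace.single (0 : Fin 3) (1 : ℝ) : V3) + w) 0 = D + w 0 := by
      rw [PiLp.add_apply, smul_e0_apply_zero]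
    rw [norm_add_sq_real, inner_smul_e0_left, norm_smul_e0_sq, ha]
    ring
  simp_rw [hexp]
  have i1 : Integrable (fun w : V3 => w 0) (stdGaussian V3) :=
    memLp_one_iff_integrable.1 (memLp_coord_stdGaussian 0 1 (by simp))
  have i2 : Integrable (fun w : V3 => (w 0) ^ 2) (stdGaussian V3) :=
    (memLp_coord_stdGaussian 0 2 (by simp)).integrable_sq
  have i3 : Integrable (fun w : V3 => ‖w‖ ^ 2) (stdGaussian V3) := integrable_norm_sq_stdGaussian
  have i4 : Integrable (fun w : V3 => ‖w‖ ^ 2 * w 0) (stdGaussian V3) := by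
    refine ((IsGaussian.memLp_id (stdGaussian V3) 3 (by simp)).integrable_norm_pow (by norm_num)).mono'
      (by fun_prop : Continuous fun w : V3 => ‖w‖ ^ 2 * w 0).aestronglyMeasurable
      (ae_of_all _ fun w => ?_)
    rw [Real.norm_eq_abs, abs_mul, abs_of_nonneg (by positivity)]
    calc ‖w‖ ^ 2 * |w 0| ≤ ‖w‖ ^ 2 * ‖w‖ :=
          mul_le_mul_of_nonneg_left (by simpa using PiLp.norm_apply_le w 0) (by positivity)
      _ = ‖w‖ ^ 3 := by ring
  have e1 : ∫ w : V3, w 0 ∂stdGaussian V3 = 0 := integral_coord_stdGaussian 0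
  have e2 : ∫ w : V3, (w 0) ^ 2 ∂stdGaussian V3 = 1 := integral_coord_sq_stdGaussian 0
  have e3 : ∫ w : V3, ‖w‖ ^ 2 ∂stdGaussian V3 = 3 := by
    rw [integral_norm_sq_stdGaussian]; simp
  have e4 := integral_norm_sq_mul_coord_std
  rw [integral_add, integral_add, integral_add, integral_add, integral_const, integral_const_mul, integral_const_mul,
    integral_const_mul, e1, e2, e3, e4]
  · simp; ring
  · exact integrable_const _
  · exact i1.const_mul _
  · exact (integrable_const _).add (i1.const_mul _)
  · exact i2.const_mul _
  · exact ((integrable_const _).add (i1.const_mul _)).add (i2.const_mul _)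
  · exact i3.const_mul _
  · exact (((integrable_const _).add (i1.const_mul _)).add (i2.const_mul _)).add (i3.const_mul _)
  · exact i4

/-- `E ‖v‖⁶ ≤ M` under `N(D e₀, id)` for `0 ≤ D ≤ 1`. [folklore] -/
theorem integral_norm_pow_six_gaussD_le {D : ℝ} (hD0 : 0 ≤ D) (hD1 : D ≤ 1) :
    ∫ v, ‖v‖ ^ 6 ∂gaussMeasure (D • (EuclideanSpace.single (0 : Fin 3) (1 : ℝ) : V3)) 1 ≤ (∫ w, (1 + ‖w‖) ^ 6 ∂stdGaussian V3) := by
  rw [integral_gaussMeasure _ one_pos]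
  simp only [Real.sqrt_one, one_smul]
  refine integral_mono_of_nonneg (ae_of_all _ fun w => by positivity) integrable_one_add_norm_pow_six_std
    (ae_of_all _ fun w => ?_)
  refine pow_le_pow_left₀ (norm_nonneg _) ((norm_add_le _ _).trans ?_) 6
  rw [norm_smul_e0 hD0]
  linarith

/-- `E ‖v‖³ ≤ 1 + M` under `N(D e₀, id)` for `0 ≤ D ≤ 1`. [folklore] -/
theorem integral_norm_pow_three_gaussD_le {D : ℝ} (hD0 : 0 ≤ D) (hD1 : D ≤ 1) :
    ∫ v, ‖v‖ ^ 3 ∂gaussMeasure (D • (EuclideanSpace.single (0 : Fin 3) (1 : ℝ) : V3)) 1 ≤ 1 + (∫ w, (1 + ‖w‖) ^ 6 ∂stdGaussian V3) := by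
  calc ∫ v, ‖v‖ ^ 3 ∂gaussMeasure (D • (EuclideanSpace.single (0 : Fin 3) (1 : ℝ) : V3)) 1 ≤ ∫ v, (1 + ‖v‖ ^ 6) ∂gaussMeasure (D • (EuclideanSpace.single (0 : Fin 3) (1 : ℝ) : V3)) 1 :=
        integral_mono (integrable_norm_pow_gauss _ 3) ((integrable_const _).add (integrable_norm_pow_gauss _ 6))
          fun v => pow_le_one_add_pow_six (norm_nonneg v) (by norm_num)
    _ = 1 + ∫ v, ‖v‖ ^ 6 ∂gaussMeasure (D • (EuclideanSpace.single (0 : Fin 3) (1 : ℝ) : V3)) 1 := by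
        rw [integral_add (integrable_const _) (integrable_norm_pow_gauss _ 6), integral_const]; simp
    _ ≤ 1 + (∫ w, (1 + ‖w‖) ^ 6 ∂stdGaussian V3) := by linarith [integral_norm_pow_six_gaussD_le hD0 hD1]

/-- **The linear response of the witness weight**: for `0 ≤ k ≤ K`, `0 < K`, `0 ≤ D`,
`E_{N(De₀,id)}[R(‖v‖²) v₀] ≥ 5D − k²D − k³ − E‖v‖⁶/K³`. [folklore] -/
theorem gamma_lower {D k K : ℝ} (hD : 0 ≤ D) (hk : 0 ≤ k) (hkK : k ≤ K) (hK : 0 < K) :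
    5 * D - k ^ 2 * D - k ^ 3 - (∫ v, ‖v‖ ^ 6 ∂gaussMeasure (D • (EuclideanSpace.single (0 : Fin 3) (1 : ℝ) : V3)) 1) / K ^ 3 ≤
      ∫ v, (if k ^ 2 < ‖v‖ ^ 2 ∧ ‖v‖ ^ 2 ≤ K ^ 2 then ‖v‖ ^ 2 - k ^ 2 else 0) * v 0 ∂gaussMeasure (D • (EuclideanSpace.single (0 : Fin 3) (1 : ℝ) : V3)) 1 := by
  set μ := gaussMeasure (D • (EuclideanSpace.single (0 : Fin 3) (1 : ℝ) : V3)) 1 with hμ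
  -- the three pieces
  set main : V3 → ℝ := fun v => (‖v‖ ^ 2 - k ^ 2) * v 0 with hmain
  set low : V3 → ℝ := fun v => if ‖v‖ ^ 2 ≤ k ^ 2 then (‖v‖ ^ 2 - k ^ 2) * v 0 else 0 with hlow
  set high : V3 → ℝ := fun v => if K ^ 2 < ‖v‖ ^ 2 then (‖v‖ ^ 2 - k ^ 2) * v 0 else 0 with hhigh
  set g : V3 → ℝ := fun v => (if k ^ 2 < ‖v‖ ^ 2 ∧ ‖v‖ ^ 2 ≤ K ^ 2 then ‖v‖ ^ 2 - k ^ 2 else 0) * v 0 with hg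
  have hkK2 : k ^ 2 ≤ K ^ 2 := pow_le_pow_left₀ hk hkK 2
  have hdec : ∀ v, g v = main v - low v - high v := by
    intro v
    simp only [hg, hmain, hlow, hhigh]
    by_cases h1 : ‖v‖ ^ 2 ≤ k ^ 2
    · have h2 : ¬ K ^ 2 < ‖v‖ ^ 2 := fun h => by linarith
      rw [if_neg (fun h => (not_lt.2 h1) h.1), if_pos h1, if_neg h2]; ring
    · by_cases h2 : K ^ 2 < ‖v‖ ^ 2
      · rw [if_neg (fun h => (not_le.2 h2) h.2), if_neg h1, if_pos h2]; ring
      · rw [if_pos ⟨not_le.1 h1, not_lt.1 h2⟩, if_neg h1, if_neg h2]; ring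
  -- pointwise bounds
  have hcoord : ∀ v : V3, |v 0| ≤ ‖v‖ := fun v => by simpa using PiLp.norm_apply_le v 0
  have hlow_bd : ∀ v, |low v| ≤ k ^ 3 := by
    intro v
    simp only [hlow]
    split_ifs with h
    · have hv : ‖v‖ ≤ k := (pow_le_pow_iff_left₀ (norm_nonneg v) hk two_ne_zero).1 h
      rw [abs_mul]
      have ha : |‖v‖ ^ 2 - k ^ 2| ≤ k ^ 2 := by
        rw [abs_of_nonpos (by linarith)]; nlinarith [norm_nonneg v]
      calc |‖v‖ ^ 2 - k ^ 2| * |v 0| ≤ k ^ 2 * k :=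
            mul_le_mul ha ((hcoord v).trans hv) (abs_nonneg _) (sq_nonneg _)
        _ = k ^ 3 := by ring
    · rw [abs_zero]; positivity
  have hhigh_bd : ∀ v, |high v| ≤ ‖v‖ ^ 6 / K ^ 3 := by
    intro v
    simp only [hhigh]
    split_ifs with h
    · have hv : K < ‖v‖ := lt_of_pow_lt_pow_left₀ 2 (norm_nonneg v) h
      have hv' : K ≤ ‖v‖ := hv.le
      rw [abs_mul]
      have ha : |‖v‖ ^ 2 - k ^ 2| ≤ ‖v‖ ^ 2 := by
        rw [abs_of_nonneg (by linarith)]; nlinarith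
      have h3 : |‖v‖ ^ 2 - k ^ 2| * |v 0| ≤ ‖v‖ ^ 3 :=
        calc |‖v‖ ^ 2 - k ^ 2| * |v 0| ≤ ‖v‖ ^ 2 * ‖v‖ := mul_le_mul ha (hcoord v) (abs_nonneg _) (sq_nonneg _)
          _ = ‖v‖ ^ 3 := by ring
      refine h3.trans ?_
      rw [le_div_iff₀ (pow_pos hK 3)]
      have hK3 : K ^ 3 ≤ ‖v‖ ^ 3 := pow_le_pow_left₀ hK.le hv' 3
      calc ‖v‖ ^ 3 * K ^ 3 ≤ ‖v‖ ^ 3 * ‖v‖ ^ 3 := mul_le_mul_of_nonneg_left hK3 (by positivity)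
        _ = ‖v‖ ^ 6 := by ring
    · rw [abs_zero]; positivity
  -- integrability
  have hg_int : Integrable g μ := by
    refine Integrable.of_bound ((((measurable_Rrad k K).comp (measurable_norm.pow_const 2)).mul
      (EuclideanSpace.proj (𝕜 := ℝ) (0 : Fin 3)).measurable).aestronglyMeasurable) (K ^ 3)
      (ae_of_all _ fun v => ?_)
    rw [Real.norm_eq_abs]
    exact abs_Rrad_mul_coord_le hk hK.le v
  have hmain_int : Integrable main μ := by
    refine integrable_of_le_pow_six (D • (EuclideanSpace.single (0 : Fin 3) (1 : ℝ) : V3)) (by fun_prop : Continuous main).aestronglyMeasurable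
      (A := 1 + k ^ 2) (B := 1 + k ^ 2) fun v => ?_
    simp only [hmain]
    rw [abs_mul]
    have h1 : |‖v‖ ^ 2 - k ^ 2| ≤ ‖v‖ ^ 2 + k ^ 2 := (abs_sub _ _).trans (by rw [abs_of_nonneg (sq_nonneg _), abs_of_nonneg (sq_nonneg _)])
    have h3 : ‖v‖ ^ 3 ≤ 1 + ‖v‖ ^ 6 := pow_le_one_add_pow_six (norm_nonneg v) (by norm_num)
    have h1' : ‖v‖ ^ 1 ≤ 1 + ‖v‖ ^ 6 := pow_le_one_add_pow_six (norm_nonneg v) (by norm_num)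
    rw [pow_one] at h1'
    calc |‖v‖ ^ 2 - k ^ 2| * |v 0| ≤ (‖v‖ ^ 2 + k ^ 2) * ‖v‖ :=
          mul_le_mul h1 (hcoord v) (abs_nonneg _) (by positivity)
      _ = ‖v‖ ^ 3 + k ^ 2 * ‖v‖ := by ring
      _ ≤ (1 + ‖v‖ ^ 6) + k ^ 2 * (1 + ‖v‖ ^ 6) := add_le_add h3 (mul_le_mul_of_nonneg_left h1' (sq_nonneg _))
      _ = (1 + k ^ 2) + (1 + k ^ 2) * ‖v‖ ^ 6 := by ring
  have hlow_meas : AEStronglyMeasurable low μ := by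
    refine (Measurable.ite (measurableSet_le (measurable_norm.pow_const 2) measurable_const) ?_
      measurable_const).aestronglyMeasurable
    exact ((measurable_norm.pow_const 2).sub measurable_const).mul (EuclideanSpace.proj (𝕜 := ℝ) (0 : Fin 3)).measurable
  have hlow_int : Integrable low μ :=
    Integrable.of_bound hlow_meas (k ^ 3) (ae_of_all _ fun v => by rw [Real.norm_eq_abs]; exact hlow_bd v)
  have hhigh_eq : high = fun v => main v - low v - g v := by
    funext v; rw [hdec v]; ring
  have hhigh_int : Integrable high μ := by
    rw [hhigh_eq]; exact (hmain_int.sub hlow_int).sub hg_int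
  have h6_int : Integrable (fun v : V3 => ‖v‖ ^ 6 / K ^ 3) μ := (integrable_norm_pow_gauss _ 6).div_const _
  -- the integrals
  have hmain_val : ∫ v, main v ∂μ = D ^ 3 + 5 * D - k ^ 2 * D := by
    have : main = fun v => ‖v‖ ^ 2 * v 0 - k ^ 2 * v 0 := by funext v; simp only [hmain]; ring
    rw [this, integral_sub, integral_const_mul, integral_norm_sq_mul_coord_gaussD, integral_coord_gaussD]
    · refine integrable_of_le_pow_six (D • (EuclideanSpace.single (0 : Fin 3) (1 : ℝ) : V3)) (by fun_prop : Continuous fun v : V3 => ‖v‖ ^ 2 * v 0).aestronglyMeasurable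
        (A := 1) (B := 1) fun v => ?_
      rw [abs_mul, abs_of_nonneg (sq_nonneg _)]
      calc ‖v‖ ^ 2 * |v 0| ≤ ‖v‖ ^ 2 * ‖v‖ := mul_le_mul_of_nonneg_left (hcoord v) (sq_nonneg _)
        _ = ‖v‖ ^ 3 := by ring
        _ ≤ 1 + ‖v‖ ^ 6 := pow_le_one_add_pow_six (norm_nonneg v) (by norm_num)
        _ = 1 + 1 * ‖v‖ ^ 6 := by ring
    · exact (memLp_one_iff_integrable.1 (memLp_coord_gaussMeasure (D • (EuclideanSpace.single (0 : Fin 3) (1 : ℝ) : V3)) 1 0 1 (by simp))).const_mul _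
  have hlow_val : ∫ v, low v ∂μ ≤ k ^ 3 := by
    calc ∫ v, low v ∂μ ≤ ∫ v, |low v| ∂μ := integral_mono hlow_int hlow_int.abs fun v => le_abs_self _
      _ ≤ ∫ _v, k ^ 3 ∂μ := integral_mono hlow_int.abs (integrable_const _) hlow_bd
      _ = k ^ 3 := by rw [integral_const]; simp
  have hhigh_val : ∫ v, high v ∂μ ≤ (∫ v, ‖v‖ ^ 6 ∂μ) / K ^ 3 := by
    calc ∫ v, high v ∂μ ≤ ∫ v, ‖v‖ ^ 6 / K ^ 3 ∂μ :=
          integral_mono hhigh_int h6_int fun v => (le_abs_self _).trans (hhigh_bd v)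
      _ = (∫ v, ‖v‖ ^ 6 ∂μ) / K ^ 3 := integral_div _ _
  have hg_val : ∫ v, g v ∂μ = (∫ v, main v ∂μ) - (∫ v, low v ∂μ) - ∫ v, high v ∂μ := by
    have : g = fun v => main v - low v - high v := funext hdec
    rw [this, integral_sub (f := fun v => main v - low v) (g := high) (hmain_int.sub hlow_int) hhigh_int,
      integral_sub hmain_int hlow_int]
  show 5 * D - k ^ 2 * D - k ^ 3 - (∫ v, ‖v‖ ^ 6 ∂μ) / K ^ 3 ≤ ∫ v, g v ∂μ
  rw [hg_val, hmain_val]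
  nlinarith [hlow_val, hhigh_val, pow_nonneg hD 3]

end Gauss

end BandCoherenceLDNegative

end Summit.AtomisticToContinuum.HydrodynamicLimit.Theorems

end
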